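import Summits.CriticalPhenomena.PercolationContinuityZ3.Theorems.PercAnnulusCrossingIICSpanningTree
import Summits.CriticalPhenomena.PercolationContinuityZ3.Theorems.PercAnnulusCrossingIICOneArmBallSum
import Summits.CriticalPhenomena.PercolationContinuityZ3.Theorems.PercNearOneGluingNoHeavyRsw3VolumeThreeBall
import HarnessLib

/-!
# The one- and two-point functions of Kesten's IIC for ALL sites, and the second moment of the IIC ball volume (lane RSW3, p1 gen 23)

builds on p205010 (kernel theorem, internal audit signed; external expert review pending) — USED through `θ(p_c) = 0` (the exact
re-rooting behind the tree formula of `…IICSpanningTree`).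

RSW3 lane (LANE 3 `prim-rsw3`), seat `prim-rsw3-p1` (gen 23).  Helper file (`--supports stmt-CriticalPhenomena-4575`); no definitions,
no sorries.  Memo `run/shared/lean/prim/rsw3/P1-QM.md` §36.

The `k = 1, 2` cases of the threshold-free tree formula of gen 22 (`…IICSpanningTree`), repackaged in the symmetric forms used by the
volume computations of gen 23 (`…IICTwoPointArbitrary`, `…IICFatAroundItsSites`):

* `exists_iicMeasure_real_openConn_le_mul_all_criticalProbI` — **`ν(0 ↔ w) ≤ C·π_{p_c}(‖w‖)` for EVERY `w ≠ 0`** (no threshold);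
* **`exists_iicMeasure_real_pair_two_sided_min_criticalProbI`** — THE PAIR FORMULA FOR ALL DISTINCT NON-ZERO SITES:
  **`c·π(min(‖x‖,‖y‖))·π(‖x − y‖) ≤ ν({0 ↔ x} ∩ {0 ↔ y}) ≤ C·π(min(‖x‖,‖y‖))·π(‖x − y‖)`** (nearest-parent insertion `0, x, y` for the nearer
  site `x`; `π(‖y‖) ≍ π(‖x − y‖)` when `‖y‖ < ‖x − y‖ ≤ 2‖y‖` by the ratio bound) — gen 21's `…IICPairFormula` needed UAD and thresholds;
* `exists_iicMeasure_real_pair_le_add_mul_criticalProbI` — the pointwise majorant **`ν({0 ↔ w} ∩ {0 ↔ w'}) ≤ C·(π(‖w‖) + π(‖w'‖))·π(‖w − w'‖)`**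
  for ALL sites `w, w'` (coincidences and the root included, `π(0) = 1`);
* **`exists_iicMeasure_sum_box_sum_box_real_openConn_inter_le_criticalProbI`** — THE SECOND MOMENT OF THE IIC BALL VOLUME:
  **`E_ν[V_m²] = Σ_{w, w' ∈ Λ(m)} ν(0 ↔ w, 0 ↔ w') ≤ C·M²·π_{p_c}(m)²`** (`m ≥ 1`, `M = (2m+1)^d`; the one-arm ball sum twice) — with the
  first moment `E_ν[V_m] ≍ M·π(m)` (gen 7 / gen 22 `…IICVolumeGivenFar`), `E_ν[V_m²] ≍ E_ν[V_m]²`: the IIC ball volume is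
  Paley–Zygmund fat at its own root (cf. gen 17's conditional fatness in finite volume).
All at `p_c(ℤ^d)`, `d ≥ 2`, under (A2)□(s,L) + `CU⁺_l`, for IIC probability measures `ν`, constants uniform in `ν`.
References: H. Kesten, PTRF 73 (1986) Thm. (8); D. Basu, A. Sapozhnikov, ECP 22 (2017) Thm. 1.1 and Remark 2.1.
-/

noncomputable section

namespace Summit.CriticalPhenomena.PercolationContinuityZ3.Theorems.Crossing

open MeasureTheory Filter Topology Literature.Probability.Percolation Literature.Probability.LatticeModels
open Literature.Probability.Percolation.DCT16
open Summit.CriticalPhenomena.PercolationContinuityZ3.Theorems.SurfaceTension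

variable {d : ℕ}

/-! ## §1 One point, every site -/

open Classical in
/-- **`ν(0 ↔ w) ≤ C·π_{p_c}(‖w‖)` FOR EVERY NON-ZERO SITE** (`p_c(ℤ^d)`, `d ≥ 2`; (A2)□(s,L) + `CU⁺_l`; the `k = 1` case of the threshold-free
tree bound of `…IICSpanningTree`). [cite: Kesten1986, Thm. (8)] -/
theorem exists_iicMeasure_real_openConn_le_mul_all_criticalProbI (hd : 2 ≤ d) {s L : ℕ} (hs : 2 ≤ s) (hsL : s ≤ L)
    {ϰ : ℝ} (hϰ : 0 < ϰ) (hA2 : SetToSetQuasiMultAspectAt d (criticalProbI d) s L ϰ) {l : ℕ} (hl : 2 ≤ l) {cU : ℝ} (hcU : 0 < cU)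
    (hCU : ∀ a : ℕ, 1 ≤ a → ∀ E : Set (BondConfig (Site d)), IsUpperSet E → MeasurableSet E →
      cU * (bondPercolation (zdGraph d) (criticalProbI d)).real E ≤ (bondPercolation (zdGraph d) (criticalProbI d)).real (E ∩
        {ω : BondConfig (Site d) | ∀ t ∈ innerBoundary (zdGraph d) (box d a), ∀ s ∈ innerBoundary (zdGraph d) (box d (l * a)),
          ∀ t' ∈ innerBoundary (zdGraph d) (box d a), ∀ s' ∈ innerBoundary (zdGraph d) (box d (l * a)),
          ω ∈ openConnIn (↑((box d (l * a) \ box d a) ∪ innerBoundary (zdGraph d) (box d a)) : Set (Site d)) t s →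
          ω ∈ openConnIn (↑((box d (l * a) \ box d a) ∪ innerBoundary (zdGraph d) (box d a)) : Set (Site d)) t' s' →
          ω ∈ openConnIn (↑((box d (l * a) \ box d a) ∪ innerBoundary (zdGraph d) (box d a)) : Set (Site d)) s s'})) :
    ∃ C : ℝ, 0 < C ∧ ∀ (ν : Measure (BondConfig (Site d))) [IsProbabilityMeasure ν],
      (∀ (F : Finset (Sym2 (Site d))) (E : Set (BondConfig (Site d))), MeasurableSet E → DeterminedBy E ↑F →
        Tendsto (fun n : ℕ => (bondPercolation (zdGraph d) (criticalProbI d)).real (E ∩ siteToBoundary d n) /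
          oneArmProb d (criticalProbI d) n) atTop (𝓝 (ν.real E))) →
      ∀ w : Site d, w ≠ 0 → ν.real (openConn (0 : Site d) w) ≤ C * oneArmProb d (criticalProbI d) (Site.supNorm w) := by
  classical
  obtain ⟨C, hC, hT⟩ := exists_iicMeasure_real_biInter_openConn_le_pow_mul_prod_nearest_all_criticalProbI hd hs hsL hϰ hA2 hl hcU hCU
  refine ⟨C, hC, fun ν _ hν w hw0 => ?_⟩
  have hw1 : 1 ≤ Site.supNorm w := by
    rcases Nat.eq_zero_or_pos (Site.supNorm w) with h0 | h0
    · exact absurd (Site.supNorm_eq_zero_iff.1 h0) hw0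
    · exact h0
  set z : ℕ → Site d := fun i => if i = 1 then w else 0 with hz
  have hz0 : z 0 = 0 := by simp [hz]
  have hz1 : z 1 = w := by simp [hz]
  have h := hT ν hν 1 z (fun _ => 0) hz0 (by intro i hi1 hi2; omega)
    (by intro i hi1 hi2; interval_cases i; rw [hz1, hz0, sub_zero]; exact hw1)
    (by intro i hi1 hi2 j hj; interval_cases i; interval_cases j; exact le_rfl)
  rw [show Finset.Icc 1 1 = ({1} : Finset ℕ) from rfl, Finset.prod_singleton, pow_one, hz1, hz0, sub_zero] at h
  have hset : (⋂ i ∈ ({1} : Finset ℕ), (openConn (0 : Site d) (z i) : Set (BondConfig (Site d)))) = openConn (0 : Site d) w := by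
    ext ω; simp only [Finset.mem_singleton, Set.mem_iInter, forall_eq, hz1]
  rw [hset] at h
  exact h

/-! ## §2 Two points, all distinct non-zero sites -/

/-- **THE PAIR FORMULA IN SYMMETRIC FORM, FOR ALL DISTINCT NON-ZERO SITES** (`p_c(ℤ^d)`, `d ≥ 2`; (A2)□ at aspect `(s,L)`, `2 ≤ s ≤ L`,
`ϰ > 0`; `CU⁺_l(c_U)`, `l ≥ 2`, `c_U > 0`; no threshold, no annulus decay): there are `0 < c, C` with
**`c·π_{p_c}(min(‖x‖,‖y‖))·π_{p_c}(‖x − y‖) ≤ ν({0 ↔ x} ∩ {0 ↔ y}) ≤ C·π_{p_c}(min(‖x‖,‖y‖))·π_{p_c}(‖x − y‖)`** for every IIC probability measure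
`ν` and all `x ≠ y`, both `≠ 0` (the `k = 2` case of the tree formula of `…IICSpanningTree` along the nearest-parent insertion `0, x, y`
for the nearer site `x`, and `π(‖y‖) ≍ π(‖x − y‖)` when `‖y‖ < ‖x − y‖ ≤ 2‖y‖` by the ratio bound).
[cite: Kesten1986, Thm. (8)] [cite: BasuSapozhnikov2017ECP, Thm. 1.1 and Remark 2.1] -/
theorem exists_iicMeasure_real_pair_two_sided_min_criticalProbI (hd : 2 ≤ d) {s L : ℕ} (hs : 2 ≤ s) (hsL : s ≤ L)
    {ϰ : ℝ} (hϰ : 0 < ϰ) (hA2 : SetToSetQuasiMultAspectAt d (criticalProbI d) s L ϰ) {l : ℕ} (hl : 2 ≤ l) {cU : ℝ} (hcU : 0 < cU)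
    (hCU : ∀ a : ℕ, 1 ≤ a → ∀ E : Set (BondConfig (Site d)), IsUpperSet E → MeasurableSet E →
      cU * (bondPercolation (zdGraph d) (criticalProbI d)).real E ≤ (bondPercolation (zdGraph d) (criticalProbI d)).real (E ∩
        {ω : BondConfig (Site d) | ∀ t ∈ innerBoundary (zdGraph d) (box d a), ∀ s ∈ innerBoundary (zdGraph d) (box d (l * a)),
          ∀ t' ∈ innerBoundary (zdGraph d) (box d a), ∀ s' ∈ innerBoundary (zdGraph d) (box d (l * a)),
          ω ∈ openConnIn (↑((box d (l * a) \ box d a) ∪ innerBoundary (zdGraph d) (box d a)) : Set (Site d)) t s →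
          ω ∈ openConnIn (↑((box d (l * a) \ box d a) ∪ innerBoundary (zdGraph d) (box d a)) : Set (Site d)) t' s' →
          ω ∈ openConnIn (↑((box d (l * a) \ box d a) ∪ innerBoundary (zdGraph d) (box d a)) : Set (Site d)) s s'})) :
    ∃ c C : ℝ, 0 < c ∧ 0 < C ∧ ∀ (ν : Measure (BondConfig (Site d))) [IsProbabilityMeasure ν],
      (∀ (F : Finset (Sym2 (Site d))) (E : Set (BondConfig (Site d))), MeasurableSet E → DeterminedBy E ↑F →
        Tendsto (fun n : ℕ => (bondPercolation (zdGraph d) (criticalProbI d)).real (E ∩ siteToBoundary d n) /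
          oneArmProb d (criticalProbI d) n) atTop (𝓝 (ν.real E))) →
      ∀ x y : Site d, x ≠ 0 → y ≠ 0 → x ≠ y →
        c * oneArmProb d (criticalProbI d) (min (Site.supNorm x) (Site.supNorm y)) * oneArmProb d (criticalProbI d) (Site.supNorm (x - y)) ≤
            ν.real ((openConn (0 : Site d) x : Set (BondConfig (Site d))) ∩ openConn (0 : Site d) y) ∧
          ν.real ((openConn (0 : Site d) x : Set (BondConfig (Site d))) ∩ openConn (0 : Site d) y) ≤
            C * oneArmProb d (criticalProbI d) (min (Site.supNorm x) (Site.supNorm y)) * oneArmProb d (criticalProbI d) (Site.supNorm (x - y)) := by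
  classical
  have hd1 : 1 ≤ d := le_trans (by norm_num) hd
  have hp : 0 < ((criticalProbI d : unitInterval) : ℝ) := by
    rw [coe_criticalProbI]; exact criticalProb_zd_pos d hd1
  have hπ : ∀ m : ℕ, 0 < oneArmProb d (criticalProbI d) m := fun m => oneArmProb_pos hd1 _ hp m
  obtain ⟨c, C, hc, hC, hT⟩ := exists_iicMeasure_real_biInter_openConn_two_sided_nearest_all_criticalProbI hd hs hsL hϰ hA2 hl hcU hCU
  obtain ⟨B, hB, hR⟩ := Rsw3.exists_oneArmProb_ratio_of_setToSetQuasiMultAspectAt hd hs hsL hϰ hA2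
  have hB1 : 1 ≤ B := by
    have h := hR 1 1 le_rfl le_rfl (by norm_num)
    nlinarith [hπ 1]
  -- the ordered case `‖x‖ ≤ ‖y‖`
  have key : ∀ (ν : Measure (BondConfig (Site d))) [IsProbabilityMeasure ν],
      (∀ (F : Finset (Sym2 (Site d))) (E : Set (BondConfig (Site d))), MeasurableSet E → DeterminedBy E ↑F →
        Tendsto (fun n : ℕ => (bondPercolation (zdGraph d) (criticalProbI d)).real (E ∩ siteToBoundary d n) /
          oneArmProb d (criticalProbI d) n) atTop (𝓝 (ν.real E))) →
      ∀ x y : Site d, x ≠ 0 → x ≠ y → Site.supNorm x ≤ Site.supNorm y →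
        c ^ 2 * oneArmProb d (criticalProbI d) (Site.supNorm x) * oneArmProb d (criticalProbI d) (Site.supNorm (x - y)) ≤
            ν.real ((openConn (0 : Site d) x : Set (BondConfig (Site d))) ∩ openConn (0 : Site d) y) ∧
          ν.real ((openConn (0 : Site d) x : Set (BondConfig (Site d))) ∩ openConn (0 : Site d) y) ≤
            C ^ 2 * B * oneArmProb d (criticalProbI d) (Site.supNorm x) * oneArmProb d (criticalProbI d) (Site.supNorm (x - y)) := by
    intro ν _ hν x y hx0 hxy hle
    have hx1 : 1 ≤ Site.supNorm x := by
      rcases Nat.eq_zero_or_pos (Site.supNorm x) with h0 | h0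
      · exact absurd (Site.supNorm_eq_zero_iff.1 h0) hx0
      · exact h0
    have hyx1 : 1 ≤ Site.supNorm (y - x) := by
      rcases Nat.eq_zero_or_pos (Site.supNorm (y - x)) with h0 | h0
      · exact absurd (sub_eq_zero.1 (Site.supNorm_eq_zero_iff.1 h0)).symm hxy
      · exact h0
    have hxy' : Site.supNorm (x - y) = Site.supNorm (y - x) := by rw [← Site.supNorm_neg, neg_sub]
    set z : ℕ → Site d := fun i => if i = 1 then x else if i = 2 then y else 0 with hz
    set par : ℕ → ℕ := fun i => if i = 2 then (if Site.supNorm (y - x) ≤ Site.supNorm y then 1 else 0) else 0 with hpar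
    have hz0 : z 0 = 0 := by simp [hz]
    have hz1 : z 1 = x := by simp [hz]
    have hz2 : z 2 = y := by simp [hz]
    have hp1 : par 1 = 0 := by simp [hpar]
    -- the second edge length `e₂ = ‖y − z (par 2)‖ = min(‖y − x‖, ‖y‖)`
    have he2 : Site.supNorm (z 2 - z (par 2)) = min (Site.supNorm (y - x)) (Site.supNorm y) := by
      by_cases h : Site.supNorm (y - x) ≤ Site.supNorm y
      · have : par 2 = 1 := by simp [hpar, h]
        rw [this, hz2, hz1, min_eq_left h]
      · have : par 2 = 0 := by simp [hpar, h]
        rw [this, hz2, hz0, sub_zero, min_eq_right (le_of_not_ge h)]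
    have hT' := hT ν hν 2 z par hz0
      (by
        intro i hi1 hi2
        interval_cases i
        · rw [hp1]; omega
        · by_cases h : Site.supNorm (y - x) ≤ Site.supNorm y <;> simp [hpar, h])
      (by
        intro i hi1 hi2
        interval_cases i
        · rw [hp1, hz1, hz0, sub_zero]; exact hx1
        · rw [he2]; exact le_min hyx1 (le_trans hx1 hle))
      (by
        intro i hi1 hi2 j hj
        interval_cases i
        · interval_cases j; rw [hp1]
        · rw [he2, hz2]
          interval_cases j
          · rw [hz0, sub_zero]; exact min_le_right _ _
          · rw [hz1]; exact min_le_left _ _)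
    have hIcc : Finset.Icc 1 2 = ({1, 2} : Finset ℕ) := by
      ext i; simp only [Finset.mem_Icc, Finset.mem_insert, Finset.mem_singleton]; omega
    rw [hIcc, Finset.prod_insert (by simp), Finset.prod_singleton, he2, hp1, hz1, hz0, sub_zero] at hT'
    have hset : (⋂ i ∈ ({1, 2} : Finset ℕ), (openConn (0 : Site d) (z i) : Set (BondConfig (Site d)))) =
        (openConn (0 : Site d) x : Set (BondConfig (Site d))) ∩ openConn (0 : Site d) y := by
      ext ω
      simp only [Finset.mem_insert, Finset.mem_singleton, Set.mem_iInter, Set.mem_inter_iff]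
      constructor
      · intro h; exact ⟨hz1 ▸ h 1 (Or.inl rfl), hz2 ▸ h 2 (Or.inr rfl)⟩
      · rintro ⟨h1, h2⟩ i (rfl | rfl)
        · rw [hz1]; exact h1
        · rw [hz2]; exact h2
    rw [hset] at hT'
    obtain ⟨hlo, hhi⟩ := hT'
    -- `π(min(‖y − x‖, ‖y‖)) ≍ π(‖x − y‖)`
    have hcmp1 : oneArmProb d (criticalProbI d) (Site.supNorm (x - y)) ≤
        oneArmProb d (criticalProbI d) (min (Site.supNorm (y - x)) (Site.supNorm y)) := by
      rw [hxy']; exact real_siteToBoundary_antitone _ (min_le_left _ _)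
    have hcmp2 : oneArmProb d (criticalProbI d) (min (Site.supNorm (y - x)) (Site.supNorm y)) ≤
        B * oneArmProb d (criticalProbI d) (Site.supNorm (x - y)) := by
      rw [hxy']
      by_cases h : Site.supNorm (y - x) ≤ Site.supNorm y
      · rw [min_eq_left h]; exact le_mul_of_one_le_left (hπ _).le hB1
      · rw [min_eq_right (le_of_not_ge h)]
        -- `‖y‖ < ‖y − x‖ ≤ ‖y‖ + ‖x‖ ≤ 2‖y‖`
        have h2 : Site.supNorm (y - x) ≤ Site.supNorm y + Site.supNorm x := by
          have := Site.supNorm_add_le y (-x); rwa [Site.supNorm_neg, ← sub_eq_add_neg] at this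
        exact hR _ _ (le_trans hx1 hle) (by omega) (by omega)
    constructor
    · calc c ^ 2 * oneArmProb d (criticalProbI d) (Site.supNorm x) * oneArmProb d (criticalProbI d) (Site.supNorm (x - y))
          ≤ c ^ 2 * oneArmProb d (criticalProbI d) (Site.supNorm x) *
              oneArmProb d (criticalProbI d) (min (Site.supNorm (y - x)) (Site.supNorm y)) :=
            mul_le_mul_of_nonneg_left hcmp1 (mul_nonneg (sq_nonneg c) (hπ _).le)
        _ ≤ _ := by rw [mul_assoc]; exact hlo
    · calc ν.real ((openConn (0 : Site d) x : Set (BondConfig (Site d))) ∩ openConn (0 : Site d) y)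
          ≤ C ^ 2 * (oneArmProb d (criticalProbI d) (Site.supNorm x) *
              oneArmProb d (criticalProbI d) (min (Site.supNorm (y - x)) (Site.supNorm y))) := hhi
        _ ≤ C ^ 2 * (oneArmProb d (criticalProbI d) (Site.supNorm x) * (B * oneArmProb d (criticalProbI d) (Site.supNorm (x - y)))) :=
            mul_le_mul_of_nonneg_left (mul_le_mul_of_nonneg_left hcmp2 (hπ _).le) (sq_nonneg C)
        _ = C ^ 2 * B * oneArmProb d (criticalProbI d) (Site.supNorm x) * oneArmProb d (criticalProbI d) (Site.supNorm (x - y)) := by ring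
  refine ⟨c ^ 2, C ^ 2 * B, pow_pos hc 2, mul_pos (pow_pos hC 2) hB, fun ν _ hν x y hx0 hy0 hxy => ?_⟩
  rcases le_total (Site.supNorm x) (Site.supNorm y) with hle | hle
  · rw [min_eq_left hle]; exact key ν hν x y hx0 hxy hle
  · rw [min_eq_right hle, Set.inter_comm, show Site.supNorm (x - y) = Site.supNorm (y - x) by rw [← Site.supNorm_neg, neg_sub]]
    exact key ν hν y x hy0 (Ne.symm hxy) hle

/-! ## §3 A pointwise majorant for all pairs, and the second moment of the IIC ball volume -/

/-- **`ν({0 ↔ w} ∩ {0 ↔ w'}) ≤ C·(π(‖w‖) + π(‖w'‖))·π(‖w − w'‖)` FOR ALL SITES `w, w'`** (`p_c(ℤ^d)`, `d ≥ 2`; (A2)□(s,L) + `CU⁺_l`): the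
pair formula for distinct non-zero sites (`π(min(a,b)) ≤ π(a) + π(b)`), the one-point bound on the diagonal and at the root, and
`π_{p_c}(0) = 1`. [cite: Kesten1986, Thm. (8)] -/
theorem exists_iicMeasure_real_pair_le_add_mul_criticalProbI (hd : 2 ≤ d) {s L : ℕ} (hs : 2 ≤ s) (hsL : s ≤ L)
    {ϰ : ℝ} (hϰ : 0 < ϰ) (hA2 : SetToSetQuasiMultAspectAt d (criticalProbI d) s L ϰ) {l : ℕ} (hl : 2 ≤ l) {cU : ℝ} (hcU : 0 < cU)
    (hCU : ∀ a : ℕ, 1 ≤ a → ∀ E : Set (BondConfig (Site d)), IsUpperSet E → MeasurableSet E →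
      cU * (bondPercolation (zdGraph d) (criticalProbI d)).real E ≤ (bondPercolation (zdGraph d) (criticalProbI d)).real (E ∩
        {ω : BondConfig (Site d) | ∀ t ∈ innerBoundary (zdGraph d) (box d a), ∀ s ∈ innerBoundary (zdGraph d) (box d (l * a)),
          ∀ t' ∈ innerBoundary (zdGraph d) (box d a), ∀ s' ∈ innerBoundary (zdGraph d) (box d (l * a)),
          ω ∈ openConnIn (↑((box d (l * a) \ box d a) ∪ innerBoundary (zdGraph d) (box d a)) : Set (Site d)) t s →
          ω ∈ openConnIn (↑((box d (l * a) \ box d a) ∪ innerBoundary (zdGraph d) (box d a)) : Set (Site d)) t' s' →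
          ω ∈ openConnIn (↑((box d (l * a) \ box d a) ∪ innerBoundary (zdGraph d) (box d a)) : Set (Site d)) s s'})) :
    ∃ C : ℝ, 0 < C ∧ ∀ (ν : Measure (BondConfig (Site d))) [IsProbabilityMeasure ν],
      (∀ (F : Finset (Sym2 (Site d))) (E : Set (BondConfig (Site d))), MeasurableSet E → DeterminedBy E ↑F →
        Tendsto (fun n : ℕ => (bondPercolation (zdGraph d) (criticalProbI d)).real (E ∩ siteToBoundary d n) /
          oneArmProb d (criticalProbI d) n) atTop (𝓝 (ν.real E))) →
      ∀ w w' : Site d, ν.real ((openConn (0 : Site d) w : Set (BondConfig (Site d))) ∩ openConn (0 : Site d) w') ≤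
        C * (oneArmProb d (criticalProbI d) (Site.supNorm w) + oneArmProb d (criticalProbI d) (Site.supNorm w')) *
          oneArmProb d (criticalProbI d) (Site.supNorm (w - w')) := by
  have hd1 : 1 ≤ d := le_trans (by norm_num) hd
  have hp : 0 < ((criticalProbI d : unitInterval) : ℝ) := by
    rw [coe_criticalProbI]; exact criticalProb_zd_pos d hd1
  have hπ : ∀ m : ℕ, 0 < oneArmProb d (criticalProbI d) m := fun m => oneArmProb_pos hd1 _ hp m
  have hπ0 : oneArmProb d (criticalProbI d) 0 = 1 := Rsw3.oneArmProb_zero hd1 _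
  obtain ⟨C₁, hC₁, h1⟩ := exists_iicMeasure_real_openConn_le_mul_all_criticalProbI hd hs hsL hϰ hA2 hl hcU hCU
  obtain ⟨c₂, C₂, hc₂, hC₂, h2⟩ := exists_iicMeasure_real_pair_two_sided_min_criticalProbI hd hs hsL hϰ hA2 hl hcU hCU
  refine ⟨max 1 (max C₁ C₂), by positivity, fun ν _ hν w w' => ?_⟩
  set C := max 1 (max C₁ C₂) with hCdef
  have hC1 : (1 : ℝ) ≤ C := le_max_left _ _
  have hCC₁ : C₁ ≤ C := le_trans (le_max_left _ _) (le_max_right _ _)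
  have hCC₂ : C₂ ≤ C := le_trans (le_max_right _ _) (le_max_right _ _)
  have hC0 : 0 ≤ C := le_trans zero_le_one hC1
  set a := oneArmProb d (criticalProbI d) (Site.supNorm w) with ha
  set b := oneArmProb d (criticalProbI d) (Site.supNorm w') with hb
  have ha0 : 0 < a := hπ _
  have hb0 : 0 < b := hπ _
  have ha1 : a ≤ 1 := measureReal_le_one
  have hb1 : b ≤ 1 := measureReal_le_one
  by_cases hw : w = 0
  · -- `w = 0`: the event is `{0 ↔ w'}`
    subst hw
    have h0 : ν.real ((openConn (0 : Site d) (0 : Site d) : Set (BondConfig (Site d))) ∩ openConn (0 : Site d) w') =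
        ν.real (openConn (0 : Site d) w') := by
      congr 1; ext ω
      exact ⟨fun h => h.2, fun h => ⟨(SimpleGraph.Reachable.refl 0 : (openGraph ω).Reachable 0 0), h⟩⟩
    rw [h0, zero_sub, Site.supNorm_neg]
    have haz : a = 1 := by rw [ha, Site.supNorm_eq_zero_iff.2 rfl, hπ0]
    by_cases hw' : w' = 0
    · subst hw'
      have hbz : b = 1 := by rw [hb, Site.supNorm_eq_zero_iff.2 rfl, hπ0]
      calc ν.real (openConn (0 : Site d) (0 : Site d)) ≤ 1 := measureReal_le_one
        _ ≤ C * (a + b) * b := by rw [haz, hbz]; nlinarith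
    · have hh1 : C₁ * b ≤ C * b := mul_le_mul_of_nonneg_right hCC₁ hb0.le
      have hh2 : 0 ≤ C * b * b := mul_nonneg (mul_nonneg hC0 hb0.le) hb0.le
      calc ν.real (openConn (0 : Site d) w') ≤ C₁ * b := h1 ν hν w' hw'
        _ ≤ C * (a + b) * b := by rw [haz]; nlinarith
  by_cases hw' : w' = 0
  · subst hw'
    have h0 : ν.real ((openConn (0 : Site d) w : Set (BondConfig (Site d))) ∩ openConn (0 : Site d) (0 : Site d)) =
        ν.real (openConn (0 : Site d) w) := by
      congr 1; ext ω
      exact ⟨fun h => h.1, fun h => ⟨h, (SimpleGraph.Reachable.refl 0 : (openGraph ω).Reachable 0 0)⟩⟩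
    rw [h0, sub_zero]
    have hbz : b = 1 := by rw [hb, Site.supNorm_eq_zero_iff.2 rfl, hπ0]
    have hh1 : C₁ * a ≤ C * a := mul_le_mul_of_nonneg_right hCC₁ ha0.le
    have hh2 : 0 ≤ C * a * a := mul_nonneg (mul_nonneg hC0 ha0.le) ha0.le
    calc ν.real (openConn (0 : Site d) w) ≤ C₁ * a := h1 ν hν w hw
      _ ≤ C * (a + b) * a := by rw [hbz]; nlinarith
  by_cases hww : w = w'
  · subst hww
    rw [Set.inter_self, sub_self, Site.supNorm_eq_zero_iff.2 rfl, hπ0, mul_one]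
    calc ν.real (openConn (0 : Site d) w) ≤ C₁ * a := h1 ν hν w hw
      _ ≤ C * (a + b) := by nlinarith
  · obtain ⟨-, hup⟩ := h2 ν hν w w' hw hw' hww
    have hmin : oneArmProb d (criticalProbI d) (min (Site.supNorm w) (Site.supNorm w')) ≤ a + b := by
      rcases le_total (Site.supNorm w) (Site.supNorm w') with h | h
      · rw [min_eq_left h]; linarith
      · rw [min_eq_right h]; linarith
    have hr0 : 0 ≤ oneArmProb d (criticalProbI d) (Site.supNorm (w - w')) := (hπ _).le
    calc ν.real ((openConn (0 : Site d) w : Set (BondConfig (Site d))) ∩ openConn (0 : Site d) w')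
        ≤ C₂ * oneArmProb d (criticalProbI d) (min (Site.supNorm w) (Site.supNorm w')) *
            oneArmProb d (criticalProbI d) (Site.supNorm (w - w')) := hup
      _ ≤ C * (a + b) * oneArmProb d (criticalProbI d) (Site.supNorm (w - w')) :=
          mul_le_mul_of_nonneg_right (mul_le_mul hCC₂ hmin (hπ _).le hC0) hr0

open Classical in
/-- **THE SECOND MOMENT OF THE IIC BALL VOLUME: `E_ν[V_m²] = Σ_{w, w' ∈ Λ(m)} ν(0 ↔ w, 0 ↔ w') ≤ C·M²·π_{p_c}(m)²`** (`p_c(ℤ^d)`, `d ≥ 2`;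
(A2)□(s,L) + `CU⁺_l`; `m ≥ 1`, `M = (2m+1)^d`): the pointwise majorant summed with the one-arm ball sum twice
(`Σ_{w ∈ Λ(m)} π(‖w‖) ≤ C_b·m^d·π(m)`, `Σ_{w' ∈ Λ(m)} π(‖w − w'‖) ≤ Σ_{u ∈ Λ(2m)} π(‖u‖) ≤ C_b·(2m)^d·π(2m)`).  Since
`E_ν[V_m] ≥ c·M·π_{p_c}(m)` (`…IICVolumeGivenFar` with `S = ∅`), `E_ν[V_m²] ≤ C'·E_ν[V_m]²`. [cite: Kesten1986, Thm. (8)] -/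
theorem exists_iicMeasure_sum_box_sum_box_real_openConn_inter_le_criticalProbI (hd : 2 ≤ d) {s L : ℕ} (hs : 2 ≤ s) (hsL : s ≤ L)
    {ϰ : ℝ} (hϰ : 0 < ϰ) (hA2 : SetToSetQuasiMultAspectAt d (criticalProbI d) s L ϰ) {l : ℕ} (hl : 2 ≤ l) {cU : ℝ} (hcU : 0 < cU)
    (hCU : ∀ a : ℕ, 1 ≤ a → ∀ E : Set (BondConfig (Site d)), IsUpperSet E → MeasurableSet E →
      cU * (bondPercolation (zdGraph d) (criticalProbI d)).real E ≤ (bondPercolation (zdGraph d) (criticalProbI d)).real (E ∩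
        {ω : BondConfig (Site d) | ∀ t ∈ innerBoundary (zdGraph d) (box d a), ∀ s ∈ innerBoundary (zdGraph d) (box d (l * a)),
          ∀ t' ∈ innerBoundary (zdGraph d) (box d a), ∀ s' ∈ innerBoundary (zdGraph d) (box d (l * a)),
          ω ∈ openConnIn (↑((box d (l * a) \ box d a) ∪ innerBoundary (zdGraph d) (box d a)) : Set (Site d)) t s →
          ω ∈ openConnIn (↑((box d (l * a) \ box d a) ∪ innerBoundary (zdGraph d) (box d a)) : Set (Site d)) t' s' →
          ω ∈ openConnIn (↑((box d (l * a) \ box d a) ∪ innerBoundary (zdGraph d) (box d a)) : Set (Site d)) s s'})) :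
    ∃ C : ℝ, 0 < C ∧ ∀ (ν : Measure (BondConfig (Site d))) [IsProbabilityMeasure ν],
      (∀ (F : Finset (Sym2 (Site d))) (E : Set (BondConfig (Site d))), MeasurableSet E → DeterminedBy E ↑F →
        Tendsto (fun n : ℕ => (bondPercolation (zdGraph d) (criticalProbI d)).real (E ∩ siteToBoundary d n) /
          oneArmProb d (criticalProbI d) n) atTop (𝓝 (ν.real E))) →
      ∀ m : ℕ, 1 ≤ m →
        ∑ w ∈ box d m, ∑ w' ∈ box d m, ν.real ((openConn (0 : Site d) w : Set (BondConfig (Site d))) ∩ openConn (0 : Site d) w') ≤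
          C * (((2 * m + 1 : ℕ) : ℝ) ^ d) ^ 2 * oneArmProb d (criticalProbI d) m ^ 2 := by
  have hd1 : 1 ≤ d := le_trans (by norm_num) hd
  have hp : 0 < ((criticalProbI d : unitInterval) : ℝ) := by
    rw [coe_criticalProbI]; exact criticalProb_zd_pos d hd1
  have hπ : ∀ m : ℕ, 0 < oneArmProb d (criticalProbI d) m := fun m => oneArmProb_pos hd1 _ hp m
  obtain ⟨C₁, hC₁, hpt⟩ := exists_iicMeasure_real_pair_le_add_mul_criticalProbI hd hs hsL hϰ hA2 hl hcU hCU
  obtain ⟨Cb, hCb, hball⟩ := exists_sum_box_oneArmProb_supNorm_le_criticalProbI hd hs hsL hϰ hA2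
  refine ⟨2 * C₁ * Cb ^ 2 * 2 ^ d, by positivity, fun ν _ hν m hm => ?_⟩
  set M : ℝ := ((2 * m + 1 : ℕ) : ℝ) ^ d with hM
  set π : ℕ → ℝ := fun k => oneArmProb d (criticalProbI d) k with hπdef
  have hM0 : 0 < M := by positivity
  have hm0 : (0 : ℝ) < m := by exact_mod_cast hm
  -- the two ball sums
  have hS1 : ∑ w ∈ box d m, π (Site.supNorm w) ≤ Cb * M * π m := by
    have h := hball m hm
    have h2 : ((m : ℕ) : ℝ) ^ d ≤ M := by
      rw [hM]; push_cast; exact pow_le_pow_left₀ hm0.le (by linarith) d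
    calc ∑ w ∈ box d m, π (Site.supNorm w) ≤ Cb * (m : ℝ) ^ d * oneArmProb d (criticalProbI d) m := h
      _ ≤ Cb * M * π m := mul_le_mul_of_nonneg_right (mul_le_mul_of_nonneg_left h2 hCb.le) (hπ m).le
  have hS2 : ∀ w ∈ box d m, ∑ w' ∈ box d m, π (Site.supNorm (w - w')) ≤ Cb * 2 ^ d * M * π m := by
    intro w hw
    have hinj : Set.InjOn (fun w' : Site d => w - w') ↑(box d m) := fun a _ b _ h => sub_right_injective h
    have h1 : ∑ w' ∈ box d m, π (Site.supNorm (w - w')) ≤ ∑ u ∈ box d (2 * m), π (Site.supNorm u) := by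
      rw [← Finset.sum_image (f := fun u => π (Site.supNorm u)) hinj]
      refine Finset.sum_le_sum_of_subset_of_nonneg ?_ fun u _ _ => (hπ _).le
      intro u hu
      obtain ⟨w', hw', rfl⟩ := Finset.mem_image.1 hu
      have h1 := mem_box_iff_supNorm_le.1 hw
      have h2 := mem_box_iff_supNorm_le.1 hw'
      have h3 : Site.supNorm (w + -w') ≤ Site.supNorm w + Site.supNorm (-w') := Site.supNorm_add_le w (-w')
      rw [Site.supNorm_neg, ← sub_eq_add_neg] at h3
      exact mem_box_iff_supNorm_le.2 (by omega)
    have h2 := hball (2 * m) (by omega)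
    have h3 : ((2 * m : ℕ) : ℝ) ^ d ≤ 2 ^ d * M := by
      rw [hM, ← mul_pow]; push_cast; exact pow_le_pow_left₀ (by positivity) (by linarith) d
    have h4 : π (2 * m) ≤ π m := real_siteToBoundary_antitone _ (by omega)
    calc ∑ w' ∈ box d m, π (Site.supNorm (w - w')) ≤ ∑ u ∈ box d (2 * m), π (Site.supNorm u) := h1
      _ ≤ Cb * ((2 * m : ℕ) : ℝ) ^ d * oneArmProb d (criticalProbI d) (2 * m) := h2
      _ ≤ Cb * (2 ^ d * M) * π m := mul_le_mul (mul_le_mul_of_nonneg_left h3 hCb.le) h4 (hπ _).le (by positivity)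
      _ = Cb * 2 ^ d * M * π m := by ring
  -- symmetrise the pointwise majorant: `Σ_{w,w'} (π(w) + π(w')) π(w − w') = 2 Σ_w π(w) Σ_{w'} π(w − w')`
  have hsum1 : ∑ w ∈ box d m, ∑ w' ∈ box d m, π (Site.supNorm w) * π (Site.supNorm (w - w')) ≤
      (Cb * M * π m) * (Cb * 2 ^ d * M * π m) := by
    calc ∑ w ∈ box d m, ∑ w' ∈ box d m, π (Site.supNorm w) * π (Site.supNorm (w - w'))
        = ∑ w ∈ box d m, π (Site.supNorm w) * ∑ w' ∈ box d m, π (Site.supNorm (w - w')) :=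
          Finset.sum_congr rfl fun w _ => by rw [Finset.mul_sum]
      _ ≤ ∑ w ∈ box d m, π (Site.supNorm w) * (Cb * 2 ^ d * M * π m) :=
          Finset.sum_le_sum fun w hw => mul_le_mul_of_nonneg_left (hS2 w hw) (hπ _).le
      _ = (∑ w ∈ box d m, π (Site.supNorm w)) * (Cb * 2 ^ d * M * π m) := by rw [Finset.sum_mul]
      _ ≤ (Cb * M * π m) * (Cb * 2 ^ d * M * π m) := by
          have : 0 ≤ Cb * 2 ^ d * M * π m := by have := hπ m; positivity
          exact mul_le_mul_of_nonneg_right hS1 this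
  have hsum2 : ∑ w ∈ box d m, ∑ w' ∈ box d m, π (Site.supNorm w') * π (Site.supNorm (w - w')) ≤
      (Cb * M * π m) * (Cb * 2 ^ d * M * π m) := by
    rw [Finset.sum_comm]
    have heq : ∀ w' ∈ box d m, ∀ w ∈ box d m, π (Site.supNorm w') * π (Site.supNorm (w - w')) =
        π (Site.supNorm w') * π (Site.supNorm (w' - w)) := by
      intro w' _ w _; rw [← Site.supNorm_neg (w - w'), neg_sub]
    rw [Finset.sum_congr rfl fun w' hw' => Finset.sum_congr rfl fun w hw => heq w' hw' w hw]
    exact hsum1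
  calc ∑ w ∈ box d m, ∑ w' ∈ box d m, ν.real ((openConn (0 : Site d) w : Set (BondConfig (Site d))) ∩ openConn (0 : Site d) w')
      ≤ ∑ w ∈ box d m, ∑ w' ∈ box d m, C₁ * (π (Site.supNorm w) + π (Site.supNorm w')) * π (Site.supNorm (w - w')) :=
        Finset.sum_le_sum fun w _ => Finset.sum_le_sum fun w' _ => hpt ν hν w w'
    _ = C₁ * (∑ w ∈ box d m, ∑ w' ∈ box d m, π (Site.supNorm w) * π (Site.supNorm (w - w')) +
          ∑ w ∈ box d m, ∑ w' ∈ box d m, π (Site.supNorm w') * π (Site.supNorm (w - w'))) := by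
        rw [← Finset.sum_add_distrib, Finset.mul_sum]
        refine Finset.sum_congr rfl fun w _ => ?_
        rw [← Finset.sum_add_distrib, Finset.mul_sum]
        exact Finset.sum_congr rfl fun w' _ => by ring
    _ ≤ C₁ * ((Cb * M * π m) * (Cb * 2 ^ d * M * π m) + (Cb * M * π m) * (Cb * 2 ^ d * M * π m)) :=
        mul_le_mul_of_nonneg_left (add_le_add hsum1 hsum2) hC₁.le
    _ = 2 * C₁ * Cb ^ 2 * 2 ^ d * M ^ 2 * π m ^ 2 := by ring

end Summit.CriticalPhenomena.PercolationContinuityZ3.Theorems.Crossing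

end
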